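import Literature.AlgebraicGeometry.Frobenioids.PadicFrobenioidPairIsoTopological
import Literature.AnabelianGeometry.AbsoluteAnabelian.GaloisSubextensionProofs
import HarnessLib

/-!
# Frobenioids II, Thm. 2.4: `G = Im(Π) ⊆ G_{ℚ_p}` IS `G_K`, "`K` the finite extension of `ℚ_p` determined by the open
# subgroup `G`" — the descended `G₁ ⥲ G₂` as an isomorphism of absolute Galois groups `G_{K₁} ⥲ G_{K₂}`

Mochizuki, *The geometry of Frobenioids II*, Kyushu J. Math. **62** (2008) 401–460, §2, setting of Definition 2.2, p. 17
ll. 5–7 [cite: MochizukiFrdII2008, Def 2.2 p.17]: "Write `G := Im(Π) ⊆ Q`; `G° := Im(Π°) ⊆ Q`; `E := 𝓑^temp(G, G°)⁰`; `K` for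
the finite extension of `ℚ_p` determined by the open subgroup `G ⊆ Q`"; Theorem 2.4, p. 19: "an outer isomorphism of
topological groups `G₁ ⥲ G₂`"; proof of (ii), p. 21: "reconstructing the multiplicative group associated to the field
… `Ψ` induces a pair of compatible isomorphisms `G₁ ⥲ G₂`; `K̄₁^× ⥲ K̄₂^×`". [cite: MochizukiFrdII2008, Thm 2.4 (ii) p.21]

PROOF-ONLY companion (cell abc-iut, `plan/L1/SUBDAG-FrdII-Thm24.md` row W12-L17 `PairIso`, node FrdII:Thm2.4(ii)).
`PadicFrobenioidPairIsoImage` / `PadicFrobenioidPairIsoTopological` deliver the printed pair at the genuine bases with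
`Gᵢ = Im φᵢ ⊆ G_{ℚ_{pᵢ}}` and the descent `ψ : Im φ₁ ≃ₜ* Im φ₂`.  Print names the finite extension `K` of `ℚ_p` "determined
by" the open subgroup `G` (so that `G = G_K`).  Using abc-iut-L4's infinite Galois theory for `K̄/K`
(`exists_intermediateField_of_isOpen_absoluteGaloisGroup`, `nonempty_continuousMulEquiv_fixingSubgroup`):

* `exists_fixedField_of_isOpenHom` — **`Im φ = Gal(ℚ̄_p/K) ≅ G_K`** for a finite `K/ℚ_p` (the fixed field of `Im φ`),
  as TOPOLOGICAL groups;
* `exists_pairIso_absoluteGaloisGroups` — the pair of Thm. 2.4 (ii) at the genuine bases with its descent transported to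
  **`isoG : G_{K₁} ≃ₜ* G_{K₂}`** satisfying `isoG ∘ (Π₁ → G_{K₁}) = (Π₂ → G_{K₂}) ∘ φ` — the shape of the binder
  `isoG` of abc-iut-L1-t7's `PadicKummerIsoOfFunctor` (Thm. 2.4 (i) row (α)), up to that file's chart data.
Theorems only; no new definitions; nothing here bears on [IUTchIII] Cor. 3.12.
-/

noncomputable section

namespace Literature.AlgebraicGeometry.Frobenioids

open CategoryTheory CategoryTheory.Limits Opposite Topology Filter Field
open Literature.AnabelianGeometry.SemiGraphs QuasiTemperoid
open Literature.AnabelianGeometry.AbsoluteAnabelian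
open Literature.NumberTheory.GaloisRepresentations

namespace BaseGaloisSystem

/-! ### §1 `G = Im(Π → G_{ℚ_p})` is the absolute Galois group of a finite extension `K/ℚ_p` -/

section Field

variable {p : ℕ} [Fact p.Prime] {G : Type} [Group G] [TopologicalSpace G]
  (φ : G →* GalFbar ℚ_[p]) (hφ : IsOpenHom φ)

/-- A continuous isomorphism between EQUAL subgroups of a topological group. [folklore] -/
private theorem nonempty_continuousMulEquiv_of_eq {H : Type*} [Group H] [TopologicalSpace H] {A B : Subgroup H}
    (h : A = B) : Nonempty (A ≃ₜ* B) := by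
  subst h
  exact ⟨ContinuousMulEquiv.refl _⟩

include hφ in
/-- **"`K`, the finite extension of `ℚ_p` determined by the open subgroup `G = Im(Π)`"** ([FrdII] p. 17): for an open
homomorphism `φ : Π → G_{ℚ_p}` there is a finite subextension `K ⊆ ℚ̄_p` of `ℚ_p` — the fixed field of `Im φ` — with
`Gal(ℚ̄_p/K) = Im φ` (infinite Galois correspondence: `Im φ` is open, hence closed) and `Im φ ≅ G_K` as TOPOLOGICAL
groups (`K̄ = ℚ̄_p`; abc-iut-L4's `nonempty_continuousMulEquiv_fixingSubgroup`). [cite: MochizukiFrdII2008, Def 2.2 p.17] -/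
theorem exists_fixedField_of_isOpenHom :
    ∃ K : IntermediateField ℚ_[p] (Fbar ℚ_[p]), FiniteDimensional ℚ_[p] K ∧
      K.fixingSubgroup.comap (absoluteGaloisGroup.toAlgEquiv ℚ_[p]).toMonoidHom = φ.range ∧
      Nonempty (φ.range ≃ₜ* absoluteGaloisGroup K) := by
  obtain ⟨K, hfin, -, hK⟩ :=
    exists_intermediateField_of_isOpen_absoluteGaloisGroup ℚ_[p] φ.range hφ.isOpen_range
  obtain ⟨e⟩ := nonempty_continuousMulEquiv_fixingSubgroup ℚ_[p] K
  obtain ⟨e₀⟩ := nonempty_continuousMulEquiv_of_eq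
    (H := absoluteGaloisGroup ℚ_[p]) (A := φ.range) (B := _) hK.symm
  exact ⟨K, hfin, hK, ⟨e₀.trans e⟩⟩

include hφ in
/-- If moreover `Π → G_{ℚ_p}` has NORMAL image (e.g. `Π = G_F` for `F/ℚ_p` Galois), `K/ℚ_p` is Galois.
[cite: MochizukiFrdII2008, Def 2.2 p.17] -/
theorem exists_fixedField_isGalois_of_isOpenHom (hn : φ.range.Normal) :
    ∃ K : IntermediateField ℚ_[p] (Fbar ℚ_[p]), FiniteDimensional ℚ_[p] K ∧ IsGalois ℚ_[p] K ∧
      K.fixingSubgroup.comap (absoluteGaloisGroup.toAlgEquiv ℚ_[p]).toMonoidHom = φ.range ∧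
      Nonempty (φ.range ≃ₜ* absoluteGaloisGroup K) := by
  obtain ⟨K, hfin, hgal, hK⟩ :=
    exists_intermediateField_of_isOpen_absoluteGaloisGroup ℚ_[p] φ.range hφ.isOpen_range
  obtain ⟨e⟩ := nonempty_continuousMulEquiv_fixingSubgroup ℚ_[p] K
  obtain ⟨e₀⟩ := nonempty_continuousMulEquiv_of_eq
    (H := absoluteGaloisGroup ℚ_[p]) (A := φ.range) (B := _) hK.symm
  exact ⟨K, hfin, hgal hn, hK, ⟨e₀.trans e⟩⟩

end Field

/-! ### §2 The descended `G₁ ⥲ G₂` as `G_{K₁} ⥲ G_{K₂}` -/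

section Pair

variable {p₁ p₂ : ℕ} [Fact p₁.Prime] [Fact p₂.Prime]
  {G : Type} [Group G] [TopologicalSpace G] [IsTopologicalGroup G] (hG : IsTempered G)
  {G₂ : Type} [Group G₂] [TopologicalSpace G₂] [IsTopologicalGroup G₂] (hG₂ : IsTempered G₂)
  (φ₁ : G →* GalFbar ℚ_[p₁]) (hφ₁ : IsOpenHom φ₁) (φ₂ : G₂ →* GalFbar ℚ_[p₂]) (hφ₂ : IsOpenHom φ₂)
  (N : ℕ → OpenNormalSubgroup G) (hN : Antitone N)
  (d₁ : PadicFrd.Datum (CosetCat G) p₁) (d₂ : PadicFrd.Datum (CosetCat G₂) p₂)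

include hG hG₂ in
/-- **[FrdII] Thm. 2.4 (ii) at the genuine bases, with the descended `G₁ ⥲ G₂` as an isomorphism of ABSOLUTE GALOIS
GROUPS `G_{K₁} ⥲ G_{K₂}` of the fields `Kᵢ/ℚ_{pᵢ}` determined by `Gᵢ = Im(Πᵢ)`.**  For fieldwise saturated data over
`𝓑^temp(Πᵢ)⁰` whose bases ARE the genuine ones through open homomorphisms `φᵢ : Πᵢ → G_{ℚ_{pᵢ}}`, `E = Ψ^Base`, the
row-L02 slot `ΨB`, and a cofinal antitone `N`: there are finite `Kᵢ ⊆ ℚ̄_{pᵢ}` with `Gal(ℚ̄_{pᵢ}/Kᵢ) = Im φᵢ`,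
identifications `eᵢ : Im φᵢ ≃ₜ* G_{Kᵢ}`, a homeomorphic `φ : Π₁ ≃ₜ* Π₂` (tower onto tower), the descent
`ψ : Im φ₁ ≃ₜ* Im φ₂` (`ψ ∘ φ₁ = φ₂ ∘ φ`), **`isoG : G_{K₁} ≃ₜ* G_{K₂}` with `isoG (e₁ (φ₁ g)) = e₂ (φ₂ (φ g))`**, and the
`φ`-equivariant `e : lim→ K̄₁^× ≅ lim→ K̄₂^×` — "an outer isomorphism of topological groups `Π₁ ⥲ Π₂` … over an outer
isomorphism of topological groups `G₁ ⥲ G₂`". [cite: MochizukiFrdII2008, Thm 2.4 (ii) p.21] -/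
theorem exists_pairIso_absoluteGaloisGroups
    (hd₁ : d₁.base = CosetCat.push φ₁ hφ₁.isOpenMap ⋙ CosetCat.toConnected (isTempered_galFbar ℚ_[p₁]) ⋙
      galoisPadicFields p₁)
    (hd₂ : d₂.base = CosetCat.push φ₂ hφ₂.isOpenMap ⋙ CosetCat.toConnected (isTempered_galFbar ℚ_[p₂]) ⋙
      galoisPadicFields p₂)
    (hfs₁ : d₁.IsFieldwiseSaturated) (hfs₂ : d₂.IsFieldwiseSaturated)
    (E : CosetCat G ≌ CosetCat G₂) (ΨB : d₁.B ≅ E.functor.op ⋙ d₂.B)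
    (hNb : ∀ U ∈ 𝓝 (1 : G), ∃ k, (N k : Set G) ⊆ U) :
    haveI := hasColimitsOfShape_nat_commMonCat.{0}
    ∃ (K₁ : IntermediateField ℚ_[p₁] (Fbar ℚ_[p₁])) (K₂ : IntermediateField ℚ_[p₂] (Fbar ℚ_[p₂]))
      (_ : FiniteDimensional ℚ_[p₁] K₁) (_ : FiniteDimensional ℚ_[p₂] K₂)
      (_ : K₁.fixingSubgroup.comap (absoluteGaloisGroup.toAlgEquiv ℚ_[p₁]).toMonoidHom = φ₁.range)
      (_ : K₂.fixingSubgroup.comap (absoluteGaloisGroup.toAlgEquiv ℚ_[p₂]).toMonoidHom = φ₂.range)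
      (e₁ : φ₁.range ≃ₜ* absoluteGaloisGroup K₁) (e₂ : φ₂.range ≃ₜ* absoluteGaloisGroup K₂)
      (φ : G ≃ₜ* G₂) (ψ : φ₁.range ≃ₜ* φ₂.range) (isoG : absoluteGaloisGroup K₁ ≃ₜ* absoluteGaloisGroup K₂)
      (N₂ : ℕ → OpenNormalSubgroup G₂) (hN₂ : Antitone N₂)
      (_ : ∀ U ∈ 𝓝 (1 : G₂), ∃ k, (N₂ k : Set G₂) ⊆ U) (_ : ∀ (k : ℕ) (g : G), g ∈ N k ↔ φ g ∈ N₂ k)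
      (e : colimit (cosetSystem N hN ⋙ PadicFrd.bZeroOn d₁.base) ≅
        colimit (cosetSystem N₂ hN₂ ⋙ PadicFrd.bZeroOn d₂.base)),
      φ₁.ker.map φ.toMulEquiv.toMonoidHom = φ₂.ker ∧
      (∀ g : G, (ψ ⟨φ₁ g, ⟨g, rfl⟩⟩ : GalFbar ℚ_[p₂]) = φ₂ (φ g)) ∧
      (∀ g : G, isoG (e₁ ⟨φ₁ g, ⟨g, rfl⟩⟩) = e₂ ⟨φ₂ (φ g), ⟨φ g, rfl⟩⟩) ∧
      ∀ g : G, e.hom ≫ colimMap (Functor.whiskerRight (toAutCoset N₂ hN₂ (φ g)).hom (PadicFrd.bZeroOn d₂.base)) =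
        colimMap (Functor.whiskerRight (toAutCoset N hN g).hom (PadicFrd.bZeroOn d₁.base)) ≫ e.hom := by
  haveI := hasColimitsOfShape_nat_commMonCat.{0}
  obtain ⟨φ, ψ, N₂, hN₂, hN₂b, hlev, e, hker, hψ, he⟩ :=
    exists_pairIso_range_topological hG hG₂ φ₁ hφ₁ φ₂ hφ₂ N hN d₁ d₂ hd₁ hd₂ hfs₁ hfs₂ E ΨB hNb
  obtain ⟨K₁, hfin₁, hK₁, ⟨e₁⟩⟩ := exists_fixedField_of_isOpenHom φ₁ hφ₁
  obtain ⟨K₂, hfin₂, hK₂, ⟨e₂⟩⟩ := exists_fixedField_of_isOpenHom φ₂ hφ₂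
  refine ⟨K₁, K₂, hfin₁, hfin₂, hK₁, hK₂, e₁, e₂, φ, ψ, e₁.symm.trans (ψ.trans e₂), N₂, hN₂, hN₂b, hlev, e, hker,
    hψ, fun g => ?_, he⟩
  have hψ' : ψ ⟨φ₁ g, ⟨g, rfl⟩⟩ = ⟨φ₂ (φ g), ⟨φ g, rfl⟩⟩ := Subtype.ext (hψ g)
  change e₂ (ψ (e₁.symm (e₁ ⟨φ₁ g, ⟨g, rfl⟩⟩))) = _
  rw [ContinuousMulEquiv.symm_apply_apply, hψ']

end Pair

end BaseGaloisSystem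

end Literature.AlgebraicGeometry.Frobenioids

end
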